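import Literature.NumberTheory.Transcendental.SemialgebraicMapsProofs
import Mathlib.MeasureTheory.Constructions.BorelSpace.Basic
import Mathlib.MeasureTheory.Measure.Lebesgue.Basic

/-!
# Route VeryGoodTransfer — proof of `stub_partitionOfPatches` (line `monomial-cube-atlas`, crux `RationalRepsResolve`)

Semialgebraic bookkeeping: a finite family of `ℚ`-semialgebraic charts `φᵢ` of the open unit cube `C`
admits `ℚ`-semialgebraic sub-pieces `τᵢ := {x ∈ C | φᵢ x ∉ ⋃_{l<i} φₗ(C)}` with `ℚ`-semialgebraic,
pairwise disjoint images and the same total image. Preimages of semialgebraic sets under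
semialgebraic maps are semialgebraic (projection of `graph ∩ cylinder`, Tarski–Seidenberg, tree
`IsSemialgebraic.image_comp`), images by `IsSemialgebraicMapOn.isSemialgebraic_image_holds`.
-/

noncomputable section

open MeasureTheory Set
open Literature.NumberTheory.Transcendental Literature.ModelTheory.ExponentialFields

namespace Summit.KontsevichZagierPeriods.VeryGoodTransfer.PartitionOfPatchesProof

variable {m n : ℕ}

/-- **Preimages under semialgebraic maps**: if `f` is `ℚ`-semialgebraic on `s ⊆ ℝᵐ` and `T ⊆ ℝⁿ` is
`ℚ`-semialgebraic then `{x ∈ s | f x ∈ T}` is `ℚ`-semialgebraic — the projection onto the first `m`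
coordinates of `graph f|ₛ ∩ (ℝᵐ × T)`. [cite: BochnakCosteRoy1998, Prop. 2.2.7] -/
theorem isSemialgebraic_sep_mem_of_isSemialgebraicMapOn {s : Set (Fin m → ℝ)}
    {f : (Fin m → ℝ) → (Fin n → ℝ)} (hf : IsSemialgebraicMapOn ℚ s f) {T : Set (Fin n → ℝ)}
    (hT : IsSemialgebraic ℚ T) : IsSemialgebraic ℚ {x ∈ s | f x ∈ T} := by
  have hW : IsSemialgebraic ℚ ({z : Fin (m + n) → ℝ | ∃ x ∈ s, z = Fin.append x (f x)} ∩
      (fun z : Fin (m + n) → ℝ => z ∘ Fin.natAdd m) ⁻¹' T) :=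
    IsSemialgebraic.inter hf (hT.preimage_comp (Fin.natAdd m))
  convert hW.image_comp (Fin.castAdd n) using 1
  ext x
  simp only [mem_image, mem_inter_iff, mem_setOf_eq, mem_preimage]
  constructor
  · rintro ⟨hxs, hxT⟩
    refine ⟨Fin.append x (f x), ⟨⟨x, hxs, rfl⟩, ?_⟩, ?_⟩
    · convert hxT using 1
      funext j
      simp
    · funext i
      simp
  · rintro ⟨z, ⟨⟨x', hx', rfl⟩, hzT⟩, rfl⟩
    have h1 : Fin.append x' (f x') ∘ Fin.castAdd n = x' := by
      funext i
      simp
    have h2 : Fin.append x' (f x') ∘ Fin.natAdd m = f x' := by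
      funext j
      simp
    rw [h2] at hzT
    rw [h1]
    exact ⟨hx', hzT⟩

/-- The open unit cube is `ℚ`-semialgebraic. [folklore] -/
theorem isSemialgebraic_cube : IsSemialgebraic ℚ {x : Fin n → ℝ | ∀ j, 0 < x j ∧ x j < 1} := by
  have : {x : Fin n → ℝ | ∀ j, 0 < x j ∧ x j < 1} =
      ⋂ j ∈ (Finset.univ : Finset (Fin n)),
        ({x : Fin n → ℝ | 0 < MvPolynomial.aeval x (MvPolynomial.X j : MvPolynomial (Fin n) ℚ)} ∩
          {x : Fin n → ℝ | 0 < MvPolynomial.aeval x (1 - MvPolynomial.X j : MvPolynomial (Fin n) ℚ)}) := by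
    ext x; simp [Set.mem_iInter, sub_pos]
  rw [this]
  exact IsSemialgebraic.biInter _ _ fun j _ =>
    (isSemialgebraic_setOf_eval_pos _).inter (isSemialgebraic_setOf_eval_pos _)

/-- **`stub_partitionOfPatches`** (stated verbatim), PROVED. [cite: BochnakCosteRoy1998, Prop. 2.2.7] -/
theorem partitionOfPatches :
    ∀ (n k : ℕ) (φ : Fin k → (Fin n → ℝ) → (Fin n → ℝ)), (∀ i, Literature.NumberTheory.Transcendental.IsSemialgebraicMapOn ℚ {x : Fin n → ℝ | ∀ j, 0 < x j ∧ x j < 1} (φ i)) → ∃ τ : Fin k → Set (Fin n → ℝ), (∀ i, τ i ⊆ {x : Fin n → ℝ | ∀ j, 0 < x j ∧ x j < 1} ∧ Literature.ModelTheory.ExponentialFields.IsSemialgebraic ℚ (τ i) ∧ Literature.ModelTheory.ExponentialFields.IsSemialgebraic ℚ (φ i '' τ i)) ∧ (∀ i j, i ≠ j → MeasureTheory.volume (φ i '' τ i ∩ φ j '' τ j) = 0) ∧ (⋃ i, φ i '' τ i) = ⋃ i, φ i '' {x : Fin n → ℝ | ∀ j, 0 < x j ∧ x j < 1} := by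
  intro n k φ hφ
  classical
  set C : Set (Fin n → ℝ) := {x | ∀ j, 0 < x j ∧ x j < 1} with hC
  have hCs : IsSemialgebraic ℚ C := isSemialgebraic_cube
  have himgC : ∀ i, IsSemialgebraic ℚ (φ i '' C) := fun i =>
    IsSemialgebraicMapOn.isSemialgebraic_image_holds (hφ i) subset_rfl hCs
  -- the images of the earlier charts
  set E : Fin k → Set (Fin n → ℝ) := fun i =>
    ⋃ l ∈ (Finset.univ.filter fun l : Fin k => l < i), φ l '' C with hE
  have hEs : ∀ i, IsSemialgebraic ℚ (E i) := fun i =>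
    IsSemialgebraic.biUnion _ _ fun l _ => himgC l
  have hmemE : ∀ {i : Fin k} {y : Fin n → ℝ}, y ∈ E i ↔ ∃ l, l < i ∧ y ∈ φ l '' C := by
    intro i y
    simp only [hE, mem_iUnion, Finset.mem_filter, Finset.mem_univ, true_and, exists_prop]
  -- the sub-pieces
  set τ : Fin k → Set (Fin n → ℝ) := fun i => {x ∈ C | φ i x ∈ (E i)ᶜ} with hτ
  have hτC : ∀ i, τ i ⊆ C := fun i x hx => hx.1
  have hτs : ∀ i, IsSemialgebraic ℚ (τ i) := fun i =>
    isSemialgebraic_sep_mem_of_isSemialgebraicMapOn (hφ i) (hEs i).compl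
  have himg : ∀ i, φ i '' τ i = φ i '' C \ E i := by
    intro i
    ext y
    constructor
    · rintro ⟨x, ⟨hxC, hxE⟩, rfl⟩
      exact ⟨⟨x, hxC, rfl⟩, hxE⟩
    · rintro ⟨⟨x, hxC, rfl⟩, hyE⟩
      exact ⟨x, ⟨hxC, hyE⟩, rfl⟩
  have himgs : ∀ i, IsSemialgebraic ℚ (φ i '' τ i) := fun i => by
    rw [himg]; exact (himgC i).diff (hEs i)
  refine ⟨τ, fun i => ⟨hτC i, hτs i, himgs i⟩, fun i j hij => ?_, ?_⟩
  · -- the images are pairwise disjoint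
    have hdis : ∀ {i j : Fin k}, i < j → φ i '' τ i ∩ φ j '' τ j = ∅ := by
      intro i j h
      ext y
      simp only [mem_inter_iff, mem_empty_iff_false, iff_false, not_and]
      intro hyi hyj
      rw [himg] at hyi hyj
      exact hyj.2 (hmemE.mpr ⟨i, h, hyi.1⟩)
    rcases lt_or_gt_of_ne hij with h | h
    · rw [hdis h, measure_empty]
    · rw [inter_comm, hdis h, measure_empty]
  · -- the total images agree
    apply subset_antisymm
    · exact iUnion_mono fun i => image_mono (hτC i)
    · intro y hy
      obtain ⟨i, hi⟩ := mem_iUnion.mp hy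
      obtain ⟨l, hl, hmin⟩ := (Finset.univ.filter fun l : Fin k => y ∈ φ l '' C).exists_min_image id
        ⟨i, by simpa using hi⟩
      have hl' : y ∈ φ l '' C := by simpa using hl
      refine mem_iUnion.mpr ⟨l, ?_⟩
      rw [himg]
      refine ⟨hl', fun hyE => ?_⟩
      obtain ⟨l', hl'lt, hyl'⟩ := hmemE.mp hyE
      have := hmin l' (by simpa using hyl')
      exact absurd this (not_le.mpr hl'lt)

end Summit.KontsevichZagierPeriods.VeryGoodTransfer.PartitionOfPatchesProof
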